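import Literature.Algebra.Homology.HyperExtSingle
import Literature.Algebra.Homology.StupidFiltrationDegeneration
import Literature.Algebra.Homology.ExtBiproduct
import HarnessLib

/-!
# Vanishing of hyper-Ext from vanishing on the columns

Let `C` be an abelian category with `HasExt.{w} C`, `A : C` and `K : CochainComplex C ℤ` strictly
concentrated in degrees `[0, b]`. The stupid filtration `σ≤n K` (`Algebra/Homology/StupidFiltration`)
exhibits `HyperExt A K k` as an iterated extension of subquotients of the COLUMN groups
`HyperExt A Kⁿ[-n] k = Ext^{k-n}(A, Kⁿ)` (`Algebra/Homology/HyperExtSingle`), `0 ≤ n ≤ b`. Hence: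

* `HyperExt.eq_zero_of_columns` — if every column group in total degree `k` vanishes
  (`Extⁱ(A, Kⁿ) = 0` whenever `n + i = k`), then `HyperExt A K k = 0` (induction along the tower
  `σ≤n K`, `Algebra/Homology/StupidFiltrationDegeneration.stupidFiltration_induction`, with the
  exactness `HyperExt A Kⁿ¹[-n₁] k → HyperExt A (σ≤n₁ K) k → HyperExt A (σ≤n₀ K) k`);
  `HyperExt.eq_zero_stupidTruncLE_of_columns` is the statement for all truncations;
* `HyperExt.eq_zero_extend_of_columns` — the same for the extension by zero `K = L.extend` of an
  `ℕ`-indexed complex `L` strictly `≤ b`, with the hypothesis on `Extⁱ(A, Lʲ)`, `j + i = k`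
  (`HomologicalComplex.extendXIso`);
* `HyperExt.eq_zero_extend_of_ext_eq_zero_of_le` — the cohomological-dimension form: if
  `Extⁱ(A, Lʲ) = 0` for all `i > d` and all `j`, then `HyperExt A (L.extend) k = 0` for `k > b + d`
  (compare `HyperExt.eq_zero_of_hasProjectiveDimensionLE`, which needs `Extⁱ(A, -) = 0` on ALL
  objects; here only the terms of `L` are constrained — the form met by complexes of `p`-power
  torsion sheaves on a `p`-adic scheme, whose cohomology vanishes above the dimension of the
  special fibre although the scheme has one dimension more).

Why: surjectivity of the odd-degree transitions `ℍ^{2r-1}(p^{r,1}_{r,N}Ω•) → ℍ^{2r-1}(p^{r,1}_{r,M}Ω•)`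
of X. Hu's complexes (arXiv:2507.12458, §8, §11) in weights `r ≥ d` reduces, by Hu's three-term short
exact sequence, to the vanishing of `ℍ^{2r}` of the kernel complex, whose terms are quotients
`Ωʲ/p^{s}` supported on the special fibre (`AlgebraicGeometry/Crystalline/HuOddTransitions`).
[folklore] Everything is proved; no named facts.
-/

universe w v u

open CategoryTheory Limits

namespace Literature.Algebra.Homology

namespace HyperExt

variable {C : Type u} [Category.{v} C] [Abelian C] [HasExt.{w} C] (A : C)
  [hA : ∀ (n : ℤ) (Y : C), HasHyperExt.{w} A ((CochainComplex.singleFunctor C n).obj Y)]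

omit hA in
/-- An `Ext` class with values in a zero object is zero. (Local copy of the one-liner of
`AlgebraicGeometry/Crystalline/DeRhamColumnsTorsionFree`, to keep the import graph low.)
[folklore] -/
private theorem ext_eq_zero_of_isZero {Y : C} (hY : IsZero Y) {b : ℕ} (y : Abelian.Ext.{w} A Y b) :
    y = 0 := by
  rw [← Abelian.Ext.comp_mk₀_id y, hY.eq_of_src (𝟙 Y) 0, Abelian.Ext.mk₀_zero,
    Abelian.Ext.comp_zero]

/-- **A column group vanishes when the corresponding `Ext` does**: if `Extⁱ(A, Kⁿ) = 0` for the
`i` with `n + i = k` (no condition when `k < n`), then `HyperExt A Kⁿ[-n] k = 0`. [folklore] -/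
theorem eq_zero_single_of_ext (K : CochainComplex C ℤ) (n k : ℤ)
    (h : ∀ i : ℕ, n + i = k → ∀ y : Abelian.Ext.{w} A (K.X n) i, y = 0)
    (x : HyperExt.{w} A ((CochainComplex.singleFunctor C n).obj (K.X n)) k) : x = 0 := by
  by_cases hkn : k < n
  · exact eq_zero_single_of_lt _ n k hkn x
  obtain ⟨i, hi⟩ : ∃ i : ℕ, n + i = k := ⟨(k - n).toNat, by omega⟩
  apply (singleEquiv (K.X n) n i k hi).injective
  rw [map_zero]
  exact h i hi _

variable (K : CochainComplex C ℤ) [K.IsStrictlyGE 0]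

/-- **Vanishing of `HyperExt A (σ≤n K) k` from the columns**: if every column group
`HyperExt A Kᵐ[-m] k` with `m ≤ n` vanishes, so does `HyperExt A (σ≤n K) k` (induction on `n` along
the exact sequences `HyperExt A Kⁿ¹[-n₁] k → HyperExt A (σ≤n₁ K) k → HyperExt A (σ≤n₀ K) k`).
[folklore] -/
theorem eq_zero_stupidTruncLE_of_columns (k : ℤ) (n : ℤ)
    (h : ∀ m : ℤ, m ≤ n → ∀ y : HyperExt.{w} A ((CochainComplex.singleFunctor C m).obj (K.X m)) k,
      y = 0)
    (x : HyperExt.{w} A (stupidTruncLE K n) k) : x = 0 := by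
  revert x
  refine stupidFiltration_induction
    (P := fun n' => n' ≤ n → ∀ x : HyperExt.{w} A (stupidTruncLE K n') k, x = 0) ?_ ?_ n le_rfl
  · intro n' hn' _ x
    exact hyperExt_stupidTruncLE_eq_zero_of_neg A K n' hn' k x
  · intro n₀ n₁ h01 ih hn₁ x
    have hx : map (X := A) (stupidTruncLEMapOfLE K n₀ n₁ (by omega)) k x = 0 :=
      ih (by omega) _
    obtain ⟨y, rfl⟩ := ((exact_map_singleToStupidTruncLE A K n₀ n₁ h01 k) _).mp hx
    rw [h n₁ hn₁ y, map_zero]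

/-- **Vanishing of `HyperExt A K k` from the columns** for `K` strictly in degrees `[0, b]`: if every
column group `HyperExt A Kⁿ[-n] k`, `n ≤ b`, vanishes then `HyperExt A K k = 0`. [folklore] -/
theorem eq_zero_of_columns (b : ℤ) [K.IsStrictlyLE b] (k : ℤ)
    (h : ∀ n : ℤ, n ≤ b → ∀ y : HyperExt.{w} A ((CochainComplex.singleFunctor C n).obj (K.X n)) k,
      y = 0)
    [HasHyperExt.{w} A K] (x : HyperExt.{w} A K k) : x = 0 := by
  apply (map_stupidTruncLEπ_bijective A K b k).injective
  rw [map_zero]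
  exact eq_zero_stupidTruncLE_of_columns A K k b h _

/-- **Vanishing from the `Ext` of the columns** for `K` strictly in degrees `[0, b]`: if
`Extⁱ(A, Kⁿ) = 0` whenever `0 ≤ n ≤ b` and `n + i = k`, then `HyperExt A K k = 0`. [folklore] -/
theorem eq_zero_of_ext_columns (b : ℤ) [K.IsStrictlyLE b] (k : ℤ)
    (h : ∀ (n : ℤ) (i : ℕ), 0 ≤ n → n ≤ b → n + i = k → ∀ y : Abelian.Ext.{w} A (K.X n) i, y = 0)
    [HasHyperExt.{w} A K] (x : HyperExt.{w} A K k) : x = 0 := by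
  refine eq_zero_of_columns A K b k (fun n hn y => eq_zero_single_of_ext A K n k (fun i hi z => ?_) y) x
  by_cases hn0 : n < 0
  · exact ext_eq_zero_of_isZero A (K.isZero_of_isStrictlyGE 0 n (by omega)) z
  · exact h n i (by omega) hn hi z

omit [K.IsStrictlyGE 0] in
/-- **Extensions by zero of `ℕ`-complexes**: for `L : CochainComplex C ℕ` strictly `≤ b` (as a
`ℤ`-complex after extension), if `Extⁱ(A, Lʲ) = 0` whenever `j ≤ b` and `j + i = k`, then
`HyperExt A (L.extend) k = 0` (`(L.extend).X j ≅ Lʲ`, `HomologicalComplex.extendXIso`). [folklore] -/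
theorem eq_zero_extend_of_columns (L : CochainComplex C ℕ) (b : ℕ)
    [CochainComplex.IsStrictlyLE (L.extend ComplexShape.embeddingUpNat) (b : ℤ)] (k : ℤ)
    (h : ∀ (j i : ℕ), j ≤ b → (j : ℤ) + i = k → ∀ y : Abelian.Ext.{w} A (L.X j) i, y = 0)
    [HasHyperExt.{w} A (L.extend ComplexShape.embeddingUpNat)]
    (x : HyperExt.{w} A (L.extend ComplexShape.embeddingUpNat) k) : x = 0 := by
  refine eq_zero_of_ext_columns A (L.extend ComplexShape.embeddingUpNat) b k
    (fun n i hn0 hnb hi y => ?_) x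
  obtain ⟨j, rfl⟩ : ∃ j : ℕ, (j : ℤ) = n := ⟨n.toNat, by omega⟩
  have e : (L.extend ComplexShape.embeddingUpNat).X (j : ℤ) ≅ L.X j :=
    L.extendXIso ComplexShape.embeddingUpNat rfl
  rw [← Ext.comp_hom_comp_inv e y,
    h j i (by exact_mod_cast hnb) hi (y.comp (Abelian.Ext.mk₀ e.hom) (add_zero i)),
    Abelian.Ext.zero_comp]

omit [K.IsStrictlyGE 0] in
/-- **Cohomological-dimension form**: for `L : CochainComplex C ℕ` strictly `≤ b` after extension, if
`Extⁱ(A, Lʲ) = 0` for every `j ≤ b` and every `i > d`, then `HyperExt A (L.extend) k = 0` for every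
`k > b + d`. Only the TERMS of `L` are constrained (not all objects of `C`, as in
`HyperExt.eq_zero_of_hasProjectiveDimensionLE`). [folklore] -/
theorem eq_zero_extend_of_ext_eq_zero_of_le (L : CochainComplex C ℕ) (b d : ℕ)
    [CochainComplex.IsStrictlyLE (L.extend ComplexShape.embeddingUpNat) (b : ℤ)]
    (h : ∀ (j i : ℕ), j ≤ b → d < i → ∀ y : Abelian.Ext.{w} A (L.X j) i, y = 0)
    (k : ℤ) (hk : (b : ℤ) + d < k)
    [HasHyperExt.{w} A (L.extend ComplexShape.embeddingUpNat)]
    (x : HyperExt.{w} A (L.extend ComplexShape.embeddingUpNat) k) : x = 0 :=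
  eq_zero_extend_of_columns A L b k (fun j i hj hi y => h j i hj (by omega) y) x

end HyperExt

end Literature.Algebra.Homology
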